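/-
Literature anchor (engines group, cap lane, anchor #48): CHAINS of mean-value-form `C¹` steps for
ELEMENTARY (code-list) fields — Moore's continuation (1979 §8.1 eq. (8.13)) from interval initial
conditions in which every step hands over the MEAN VALUE EXTENSION `φ(h, m) + J1·(W − m)` of the
flow map (`ElementaryFieldMeanValueCertificate.lean`, Moore 1979 §4.3 (4.19); Zgliczyński's
`C¹`-Lohner evaluation) intersected with the direct Taylor box: the whole transcript is one
kernel-decidable `Bool` with a soundness theorem (existence on the horizon, every-solution
enclosures at the mesh points).  The pendulum from the BOX `[0.99, 1.01] × [−0.01, 0.01]`, four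
steps of `1/8`: `x(1/2)` is certified in a box of widths `0.0306 × 0.0265`, against
`0.0334 × 0.0347` for the direct chain of `ElementaryFieldChainCertificate.lean` from the same box
(kernel-checked inclusion).
-/
import Literature.Analysis.ODE.ElementaryFieldMeanValueCertificate
import Literature.Analysis.ODE.ElementaryFieldChainCertificate
import HarnessLib

/-!
# Kernel-checkable chains of mean-value-form steps for elementary fields

Topic `Literature/Analysis/ODE`.  R. E. Moore, *Methods and Applications of Interval Analysis*
(SIAM 1979): §8.1 eq. (8.13) continues a validated solution "from the new, *interval* initial
conditions", §8.2 warns that handing over interval boxes step after step suffers from the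
wrapping effect, and §4.3 eq. (4.19) is the mean value extension
`f(X) ⊆ f(m) + ∑ᵢ DᵢF(X)(Xᵢ − mᵢ)`; P. Zgliczyński, *C¹-Lohner algorithm* (Found. Comput. Math. 2
(2002)) §3 evaluates the time step as `φ(h,[x]) ⊂ Φ(h, m) + ∂Φ/∂x(h,[x])([x] − m)`;
Mrozek–Zgliczyński 2000 §7.5 Lemma 7.6 ("improved bounds via interval sets") is the propagation of
an interval set by this form and §8 (p. 249) explains that iterating it is where the wrapping
effect lives.  `MeanValueChainCertificate.lean` made the ITERATED MEAN VALUE FORM a single `Bool`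
decided by the kernel for POLYNOMIAL fields; this file does the same for ELEMENTARY fields given
by code lists (`FExpr`: `+ − × ÷`, `exp`, `log`, `sin`, `cos`, `√`, powers), iterating the
one-step certificate `EMVStepCert` of `ElementaryFieldMeanValueCertificate.lean` along the mesh of
`ElementaryFieldChainCertificate.lean`:

* `EMVStage n` = the data of one step (order, step, box `Wⱼ`, a-priori boxes `Sⱼ`, `VVⱼ`, centre
  `mⱼ`, the point certificate's order and a-priori box); `EMVChainCert n` = code lists,
  precision, stages, final box; `EMVChainCert.toHOEChain` forgets everything but the mesh data:
  the mesh `τⱼ` and its bookkeeping (`HOEChainCert.mesh`, `meshQ`, `mesh_step`, `cast_meshQ`, …)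
  are REUSED, not restated;
* `EMVChainCert.check` runs, for every stage, the mean value step check `EMVStepCert.check`
  (state HOE test, `C¹` HOE test, centre in `Wⱼ`, point certificate from the centre — all over the
  derived code lists) AND the landing test `meetEndBoxⱼ ⊆ W_{j+1}` (`boxLE`),
  `meetEndBox = (endBox(mⱼ) + J1ⱼ·(Wⱼ − mⱼ)) ∩ endBox(Wⱼ)`, with `W_N` the final box;
* `EMVChainCert.sound`: if `check = true` then from every real `y₀ ∈ W₀` a solution exists on
  `[0, τ_N]`, and EVERY solution from `y₀` has `y(τⱼ) ∈ Wⱼ` (`j ≤ N`),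
  `y(τⱼ₊₁) ∈ meetEndBoxⱼ` and `y(t) ∈ Sⱼ` on `[τⱼ, τⱼ₊₁]` — the abstract chain theorems of
  `StepChain.lean` fed with `EMVStepCert.exists_of_check` / `mem_meetEndBox` and the state
  certificate's a-priori enclosure per step; `EMVChainCert.mem_final`: `y(τ_N) ∈ W_N`;
* `emvChainVerifier n : Verifier (EChainInstance n) EChainInstance.Claim` — a SECOND certificate
  format (precision, list of `EMVStage`s) for the SAME instances and claims as `eChainVerifier`
  (code lists, initial box, horizon, final box ↦ existence and `y(T) ∈ F`).

WORKED EXAMPLE (kernel): the pendulum `x₁' = x₂`, `x₂' = −sin x₁` from the BOX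
`W₀ = [0.99, 1.01] × [−0.01, 0.01]`, four steps of `h = 1/8`, `C¹` part at order `4`, point
certificates at order `6`, centres = midpoints, hand-over boxes = `meetEndBox` rounded outward to
`10⁻⁷`, a-priori boxes from a crude Euler guess (all by an untrusted search, recorded as data):
`pendulumBoxMVChain_check` (by `decide`, ≈ 40 s), `pendulumBoxMVChain_final` (every solution from
every `y₀ ∈ W₀` has `x(1/2) ∈ [0.8807098, 0.9113553] × [−0.424149, −0.3976079]`, widths
`0.0306`, `0.0265`), `pendulumBoxMVChain_exists`, and — the comparison, kernel-checked — the
DIRECT transcript `pendulumBoxDirectChain` (an `EChainCert` of `ElementaryFieldChainCertificate.lean`: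
same field, box, mesh and order, hand-over = direct end boxes) is accepted too
(`pendulumBoxDirectChain_check`) and `pendulumBoxMVChain_final_le_direct`: the mean value final box
lies inside the direct one `[0.8793499, 0.9127144] × [−0.4282153, −0.3935533]` (widths `0.0334`,
`0.0347`).  Per step the mean value hand-over boxes have widths `(0.0224, 0.0213)`,
`(0.0250, 0.0228)`, `(0.0277, 0.0245)`, `(0.0306, 0.0265)` and the direct ones `(0.0227, 0.0230)`,
`(0.0258, 0.0264)`, `(0.0293, 0.0303)`, `(0.0334, 0.0347)`.  Honest limits: the pendulum flow near
`(1, 0)` shears, so interval sets still wrap (MZ2000 §8) — the widths grow by ≈ 10 % per step even in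
mean value form, and the remedy (parallelepipeds / QR, Lohner; `DoubletonChainCertificate.lean` for
polynomial fields) is NOT formalised here for elementary fields; exact rationals, no rounding model;
the precision of the data is whatever the untrusted stage chose.  No facts, no axioms beyond the
standard three, no `sorry`.  AI-produced formalisation (H21 engines seat eng-cap-3, 2026-08-22).

## References

* R. E. Moore, *Methods and Applications of Interval Analysis*, SIAM 1979, §4.3 eq. (4.19),
  §8.1 eqs. (8.10), (8.13), §8.2 (wrapping effect), §3.4 (derived programs).
  [held: lit key book:moorend-methods-applications-interval-analysis]
* P. Zgliczyński, *C¹-Lohner algorithm*, Found. Comput. Math. 2 (2002) 429–465, §3.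
* M. Mrozek, P. Zgliczyński, *Set arithmetic and the enclosing problem in dynamics*, Ann. Polon.
  Math. 74 (2000) 237–259, Theorem 7.5, §7.5 Lemma 7.6, §8 (p. 249).
  [held: lit key paper:doi-10-4064-ap-74-1-237-259]
* N. S. Nedialkov, K. R. Jackson, G. F. Corliss, *Validated solutions of initial value problems
  for ordinary differential equations*, Appl. Math. Comput. 105 (1999) 21–68, §5 Algorithm I.
* I. Walawska, D. Wilczak, *An implicit algorithm for validated enclosures of the solutions to
  variational equations for ODEs*, Appl. Math. Comput. 291 (2016), §2. [held: arXiv:1509.07388]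
* R. E. Moore, *Interval Analysis*, Prentice-Hall 1966, §4.4.
-/

set_option autoImplicit false

open Set NonemptyInterval
open Literature.Analysis.ValidatedNumerics Literature.Analysis.ValidatedNumerics.ITaylor
open Literature.Analysis.ODE.FExpr

namespace Literature.Analysis.ODE

/-! ### Stages and the chain checker -/

section Chain

variable {n : ℕ}

/-- One **stage** of a mean-value-form step chain for an elementary field: order `Kⱼ`, step `hⱼ`,
the box `Wⱼ` of values at `τⱼ`, the a-priori boxes `Sⱼ ⊇ y([τⱼ, τⱼ₊₁])` and `VVⱼ ⊇ V([0, hⱼ])`,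
the rational centre `mⱼ ∈ Wⱼ`, and the order and a-priori box of the point certificate from `mⱼ`.
[cite: Moore1979, §4.3 eq. (4.19)] [cite: Moore1979, §8.1 eq. (8.13)]
[cite: Zgliczynski2002C1Lohner, §3 (C¹-Lohner algorithm: evaluation φ(h,[x]) ⊂ Φ(h,m) + ∂Φ/∂x(h,[x])([x] − m))] -/
structure EMVStage (n : ℕ) where
  /-- The order `Kⱼ ≥ 1` of the `C¹` step. -/
  order : ℕ
  /-- The step size `hⱼ ≥ 0`. -/
  step : ℚ
  /-- The box `Wⱼ` of admissible values at the left mesh point. -/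
  init : Fin n → Iv
  /-- The claimed a-priori enclosure `Sⱼ` of the states over the step. -/
  apriori : Fin n → Iv
  /-- The claimed a-priori enclosure `VVⱼ` of the fundamental matrix over the step. -/
  varApriori : Fin n → Fin n → Iv
  /-- The rational centre `mⱼ ∈ Wⱼ`. -/
  center : Fin n → ℚ
  /-- The order of the point certificate from the centre. -/
  centerOrder : ℕ
  /-- The a-priori enclosure of the solution from the centre over the step. -/
  centerApriori : Fin n → Iv

/-- The mean value step certificate of a stage for the code lists `F` at precision `cfg`.
[cite: Moore1979, §4.3 eq. (4.19)] [cite: Zgliczynski2002C1Lohner, §3 (C¹-Lohner algorithm: evaluation φ(h,[x]) ⊂ Φ(h,m) + ∂Φ/∂x(h,[x])([x] − m))] -/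
def EMVStage.toCert (F : Fin n → FExpr n) (cfg : SeedCfg) (s : EMVStage n) : EMVStepCert n :=
  ⟨⟨F, s.order, s.step, s.init, s.apriori, s.varApriori, cfg⟩, s.center, s.centerOrder,
    s.centerApriori⟩

/-- Forgetting the mean value data of a stage gives a stage of the direct method (same order,
step, box `Wⱼ` and a-priori box `Sⱼ`; `ElementaryFieldChainCertificate.lean`).
[cite: Moore1979, §8.1 eq. (8.13)] [cite: NedialkovJacksonCorliss1999, §5 Algorithm I] -/
def EMVStage.toHOEStage (s : EMVStage n) : HOEStage n :=
  ⟨s.order, s.step, s.init, s.apriori⟩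

/-- The padding stage built on a box `fin` (order `0`, step `0`, all boxes `fin`, zero matrix box
and centre), used beyond the last step so that `W_N` is the final box.
[cite: NedialkovJacksonCorliss1999, §5 Algorithm I] -/
def EMVStage.padOf (fin : Fin n → Iv) : EMVStage n :=
  ⟨0, 0, fin, fin, fun _ _ => pure 0, fun _ => 0, 0, fin⟩

/-- The box the end enclosure of the current stage must land in: the initial box of the next
stage, or the final box after the last stage. [cite: NedialkovJacksonCorliss1999, §5 Algorithm I] -/
def emvNextInit (fin : Fin n → Iv) : List (EMVStage n) → Fin n → Iv
  | [] => fin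
  | s :: _ => s.init

/-- **The chain checker** on a list of mean value stages of an elementary field: every stage
passes the mean value step check and its `meetEndBox = mvEndBox ∩ endBox` lands in the next
initial box (in the final box for the last stage). [cite: Moore1979, §8.1 eq. (8.13)]
[cite: Moore1979, §4.3 eq. (4.19)] [cite: MrozekZgliczynski2000, §7.5 Lemma 7.6] -/
def emvChainCheck (F : Fin n → FExpr n) (cfg : SeedCfg) (fin : Fin n → Iv) :
    List (EMVStage n) → Bool
  | [] => true
  | s :: rest =>
      (s.toCert F cfg).check && boxLE (s.toCert F cfg).meetEndBox (emvNextInit fin rest) &&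
        emvChainCheck F cfg fin rest

/-- A **mean-value-form step-chain certificate for an elementary field**: the code lists of the
components of `f`, the precision parameters of the derived program, the stages, and the claimed
enclosure `W_N` of the values at the end of the mesh. [cite: Moore1979, §8.1 eq. (8.13)]
[cite: MrozekZgliczynski2000, §7.5 Lemma 7.6] [cite: Moore1979, §3.4 procedure steps 1–4] -/
structure EMVChainCert (n : ℕ) where
  /-- The vector field, one code list per component. -/
  field : Fin n → FExpr n
  /-- Precision parameters of the derived program (shared by all stages). -/
  cfg : SeedCfg
  /-- The stages, in temporal order. -/
  stages : List (EMVStage n)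
  /-- The claimed final box `W_N ∋ y(τ_N)`. -/
  final : Fin n → Iv

namespace EMVChainCert

variable (c : EMVChainCert n)

/-- Number of steps `N`. [cite: NedialkovJacksonCorliss1999, §5 Algorithm I] -/
def size : ℕ := c.stages.length

/-- The padding stage (all boxes the final box). [cite: NedialkovJacksonCorliss1999, §5 Algorithm I] -/
def padStage : EMVStage n := EMVStage.padOf c.final

/-- Stage `j` (the padding stage for `j ≥ N`). [cite: NedialkovJacksonCorliss1999, §5 Algorithm I] -/
def stageAt (j : ℕ) : EMVStage n := c.stages.getD j c.padStage

/-- The mean value step certificate of stage `j`. [cite: Moore1979, §4.3 eq. (4.19)]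
[cite: MrozekZgliczynski2000, §7.5 Lemma 7.6] -/
def certAt (j : ℕ) : EMVStepCert n := (c.stageAt j).toCert c.field c.cfg

/-- The box `Wⱼ` at mesh point `j` (`W_N` = the final box). [cite: Moore1979, §8.1 eq. (8.13)] -/
def initAt (j : ℕ) : Fin n → Iv := (c.stageAt j).init

/-- **The underlying mesh transcript** (`HighOrderChainCertificate.lean`): orders, steps, boxes
`Wⱼ`, `Sⱼ` and final box, the field slot left empty and the mean value data forgotten.  Its mesh
`τⱼ` (`HOEChainCert.mesh` / `meshQ`) and bookkeeping are REUSED for the mean value chain; its own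
`check` is not. [cite: Moore1979, §8.1 eq. (8.13)] [cite: NedialkovJacksonCorliss1999, §5 Algorithm I] -/
def toHOEChain : HOEChainCert n := ⟨fun _ => [], c.stages.map EMVStage.toHOEStage, c.final⟩

/-- **The checker** of a mean-value-form step-chain certificate for an elementary field.
[cite: Moore1979, §8.1 eq. (8.13)] [cite: Moore1979, §4.3 eq. (4.19)]
[cite: MrozekZgliczynski2000, §7.5 Lemma 7.6] -/
def check : Bool := emvChainCheck c.field c.cfg c.final c.stages

variable {c}

/-- Stage `j` of the underlying transcript is stage `j` with the mean value data forgotten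
(`List.getD` commutes with `map`). [folklore] -/
private theorem toHOEChain_stageAt (j : ℕ) : c.toHOEChain.stageAt j = (c.stageAt j).toHOEStage := by
  show (c.stages.map EMVStage.toHOEStage).getD j (EMVStage.toHOEStage c.padStage) = _
  rw [List.getD_map]
  rfl

/-- Same steps `hⱼ` (definitional bookkeeping). [folklore] -/
private theorem toHOEChain_step (j : ℕ) : (c.toHOEChain.stageAt j).step = (c.stageAt j).step := by
  rw [toHOEChain_stageAt]; rfl

/-- The length of step `j` of the shared mesh is `hⱼ` (definitional bookkeeping). [folklore] -/
private theorem toHOEChain_mesh_step (j : ℕ) :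
    c.toHOEChain.mesh (j + 1) - c.toHOEChain.mesh j = ((c.stageAt j).step : ℝ) := by
  rw [HOEChainCert.mesh_step, toHOEChain_step]

/-- Stage `N` is the padding stage (`List.getD` past the end). [folklore] -/
private theorem stageAt_size : c.stageAt c.size = c.padStage := by
  simp [stageAt, size]

/-- What the chain checker establishes, stage by stage. [cite: NedialkovJacksonCorliss1999, §5 Algorithm I]
[cite: MrozekZgliczynski2000, §7.5 Lemma 7.6] -/
theorem emvChainCheck_spec {F : Fin n → FExpr n} {cfg : SeedCfg} {fin : Fin n → Iv} :
    ∀ (l : List (EMVStage n)), emvChainCheck F cfg fin l = true → ∀ j < l.length,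
      ((l.getD j (EMVStage.padOf fin)).toCert F cfg).check = true ∧
        boxLE ((l.getD j (EMVStage.padOf fin)).toCert F cfg).meetEndBox
          (l.getD (j + 1) (EMVStage.padOf fin)).init = true
  | [], _, j, hj => absurd hj (Nat.not_lt_zero j)
  | s :: rest, h, j, hj => by
      simp only [emvChainCheck, Bool.and_eq_true] at h
      obtain ⟨⟨h1, h2⟩, h3⟩ := h
      cases j with
      | zero =>
          refine ⟨by simpa using h1, ?_⟩
          cases rest with
          | nil => simpa [emvNextInit, EMVStage.padOf] using h2
          | cons s' rest' => simpa [emvNextInit] using h2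
      | succ j =>
          simp only [List.getD_cons_succ]
          exact emvChainCheck_spec rest h3 j (by simpa using hj)

/-- Stage `j < N` of an accepted chain: its mean value step certificate is accepted and its
`meetEndBox` lands in `W_{j+1}`. [cite: NedialkovJacksonCorliss1999, §5 Algorithm I]
[cite: MrozekZgliczynski2000, §7.5 Lemma 7.6] -/
theorem check_stage (hc : c.check = true) {j : ℕ} (hj : j < c.size) :
    (c.certAt j).check = true ∧ boxLE (c.certAt j).meetEndBox (c.initAt (j + 1)) = true :=
  emvChainCheck_spec c.stages hc j hj

/-- The state certificate of an accepted stage is accepted. [cite: Moore1979, §8.1 eq. (8.10)] -/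
theorem check_toE (hc : c.check = true) {j : ℕ} (hj : j < c.size) :
    (c.certAt j).toE.check = true :=
  (EVarStepCert.check_spec (EMVStepCert.check_spec (check_stage hc hj).1).1).1

/-- **The landing step**: every solution from `x ∈ Wⱼ` over step `j` ends in `W_{j+1}`
(`∈ meetEndBoxⱼ ⊆ W_{j+1}`). [cite: Moore1979, §8.1 eq. (8.13)] [cite: Moore1979, §4.3 eq. (4.19)]
[cite: MrozekZgliczynski2000, §7.5 Lemma 7.6] -/
theorem landing (hc : c.check = true) {j : ℕ} (hj : j < c.size) {x : Fin n → ℝ}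
    (hx : x ∈ boxSet (castBox (c.initAt j))) {z : ℝ → Fin n → ℝ} (hz0 : z 0 = x)
    (hz : ∀ t ∈ Icc 0 ((c.stageAt j).step : ℝ),
      HasDerivWithinAt z (fieldFun c.field (z t)) (Icc 0 ((c.stageAt j).step : ℝ)) t) :
    z (c.stageAt j).step ∈ boxSet (castBox (c.initAt (j + 1))) := by
  obtain ⟨hcj, hland⟩ := check_stage hc hj
  exact boxSet_mono (castBox_mono (le_of_boxLE hland)) (EMVStepCert.mem_meetEndBox hcj hx hz0 hz)

/-- **Soundness of the mean-value-form step-chain certificate for an elementary field** (Moore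
1979 §8.1 (8.13): continuation from interval initial conditions, each hand-over evaluated in the
mean value form (4.19) of the flow map — Zgliczyński's `C¹`-Lohner evaluation — intersected with
the direct Taylor box; MZ2000 Lemma 7.6 iterated along the mesh `τⱼ`). If `check` accepts, then
from every `y₀ ∈ W₀` a solution of `y' = f(y)` exists on `[0, τ_N]`, and EVERY solution `y` from
`y₀` on `[0, τ_N]` satisfies `y(τⱼ) ∈ Wⱼ` for `j ≤ N`, `y(τⱼ₊₁) ∈ meetEndBoxⱼ` and `y(t) ∈ Sⱼ`
on `[τⱼ, τⱼ₊₁]` for `j < N`. [cite: Moore1979, §8.1 eq. (8.13)] [cite: Moore1979, §4.3 eq. (4.19)]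
[cite: MrozekZgliczynski2000, §7.5 Lemma 7.6] [cite: NedialkovJacksonCorliss1999, §5 Algorithm I]
[cite: Zgliczynski2002C1Lohner, §3 (C¹-Lohner algorithm: evaluation φ(h,[x]) ⊂ Φ(h,m) + ∂Φ/∂x(h,[x])([x] − m))] -/
theorem sound (hc : c.check = true) {y₀ : Fin n → ℝ} (hy₀ : y₀ ∈ boxSet (castBox (c.initAt 0))) :
    (∃ y : ℝ → Fin n → ℝ, y 0 = y₀ ∧
        ∀ t ∈ Icc 0 (c.toHOEChain.mesh c.size),
          HasDerivWithinAt y (fieldFun c.field (y t)) (Icc 0 (c.toHOEChain.mesh c.size)) t) ∧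
      ∀ y : ℝ → Fin n → ℝ, y 0 = y₀ →
        (∀ t ∈ Icc 0 (c.toHOEChain.mesh c.size),
            HasDerivWithinAt y (fieldFun c.field (y t)) (Icc 0 (c.toHOEChain.mesh c.size)) t) →
          (∀ j ≤ c.size, y (c.toHOEChain.mesh j) ∈ boxSet (castBox (c.initAt j))) ∧
            (∀ j < c.size,
                y (c.toHOEChain.mesh (j + 1)) ∈ boxSet (castBox (c.certAt j).meetEndBox)) ∧
              ∀ j < c.size, ∀ t ∈ Icc (c.toHOEChain.mesh j) (c.toHOEChain.mesh (j + 1)),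
                y t ∈ boxSet (castBox (c.stageAt j).apriori) := by
  -- the per-step enclosure relation of the abstract chain theorems
  set Q : ℕ → ℝ → (Fin n → ℝ) → (Fin n → ℝ) → Prop := fun j s _ w =>
    w ∈ boxSet (castBox (c.stageAt j).apriori) ∧
      (s = ((c.stageAt j).step : ℝ) → w ∈ boxSet (castBox (c.certAt j).meetEndBox))
  set τ : ℕ → ℝ := c.toHOEChain.mesh
  have hτ0 : τ 0 = 0 := HOEChainCert.mesh_zero
  have hτs : ∀ j, τ (j + 1) - τ j = ((c.stageAt j).step : ℝ) := toHOEChain_mesh_step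
  have hτ : ∀ j < c.size, τ j ≤ τ (j + 1) := fun j hj => by
    show c.toHOEChain.mesh j ≤ c.toHOEChain.mesh (j + 1)
    rw [HOEChainCert.mesh_succ, toHOEChain_step]
    exact le_add_of_nonneg_right (EStepCert.check_spec (check_toE hc hj)).2.1
  have hall : ∀ j < c.size, ∀ x ∈ boxSet (castBox (c.initAt j)), ∀ z : ℝ → Fin n → ℝ, z 0 = x →
      (∀ s ∈ Icc 0 (τ (j + 1) - τ j),
        HasDerivWithinAt z (fieldFun c.field (z s)) (Icc 0 (τ (j + 1) - τ j)) s) →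
      ∀ s ∈ Icc 0 (τ (j + 1) - τ j), Q j s x (z s) := by
    intro j hj x hx z hz0 hz s hs
    rw [hτs] at hz hs
    have hcj := (check_stage hc hj).1
    show z s ∈ boxSet (castBox (c.stageAt j).apriori) ∧
      (s = ((c.stageAt j).step : ℝ) → z s ∈ boxSet (castBox (c.certAt j).meetEndBox))
    refine ⟨((EStepCert.sound (check_toE hc hj) hx).2 z hz0 hz s hs).1, fun hs' => ?_⟩
    rw [hs']
    exact EMVStepCert.mem_meetEndBox hcj hx hz0 hz
  have hland : ∀ j < c.size, ∀ x ∈ boxSet (castBox (c.initAt j)), ∀ w,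
      Q j (τ (j + 1) - τ j) x w → w ∈ boxSet (castBox (c.initAt (j + 1))) := by
    intro j hj x _ w hw
    obtain ⟨-, hw⟩ := hw
    exact boxSet_mono (castBox_mono (le_of_boxLE (check_stage hc hj).2)) (hw (hτs j))
  refine ⟨?_, fun y hy0 hy => ?_⟩
  · have hstep : ∀ j < c.size, ∀ x ∈ boxSet (castBox (c.initAt j)), ∃ z : ℝ → Fin n → ℝ, z 0 = x ∧
        (∀ s ∈ Icc 0 (τ (j + 1) - τ j),
          HasDerivWithinAt z (fieldFun c.field (z s)) (Icc 0 (τ (j + 1) - τ j)) s) ∧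
        ∀ s ∈ Icc 0 (τ (j + 1) - τ j), Q j s x (z s) := by
      intro j hj x hx
      obtain ⟨z, hz0, hz⟩ := EMVStepCert.exists_of_check (check_stage hc hj).1 hx
      refine ⟨z, hz0, ?_, ?_⟩
      · rw [hτs]; exact hz
      · exact hall j hj x hx z hz0 (by rw [hτs]; exact hz)
    obtain ⟨y, hy0, hy, -, -⟩ :=
      exists_solution_of_stepChain (f := fieldFun c.field)
        (W := fun j => boxSet (castBox (c.initAt j))) (Q := Q) c.size hτ0 hτ hstep hland hy₀
    exact ⟨y, hy0, hy⟩
  · have hyW : y 0 ∈ boxSet (castBox (c.initAt 0)) := hy0 ▸ hy₀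
    obtain ⟨hW, hQ'⟩ :=
      solution_mem_of_stepChain (f := fieldFun c.field)
        (W := fun j => boxSet (castBox (c.initAt j))) (Q := Q) c.size hτ0 hτ hall hland hyW hy
    refine ⟨hW, fun j hj => ?_, fun j hj t ht => ?_⟩
    · have hmem : τ (j + 1) ∈ Icc (τ j) (τ (j + 1)) := ⟨hτ j hj, le_rfl⟩
      obtain ⟨-, h2⟩ := hQ' j hj _ hmem
      exact h2 (hτs j)
    · obtain ⟨h1, -⟩ := hQ' j hj t ht
      exact h1

/-- **The certified final box**: every solution on `[0, τ_N]` starting in `W₀` has `y(τ_N) ∈ W_N`.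
[cite: Moore1979, §8.1 eq. (8.13)] [cite: MrozekZgliczynski2000, §7.5 Lemma 7.6] -/
theorem mem_final (hc : c.check = true) {y : ℝ → Fin n → ℝ}
    (hy0 : y 0 ∈ boxSet (castBox (c.initAt 0)))
    (hy : ∀ t ∈ Icc 0 (c.toHOEChain.mesh c.size),
      HasDerivWithinAt y (fieldFun c.field (y t)) (Icc 0 (c.toHOEChain.mesh c.size)) t) :
    y (c.toHOEChain.mesh c.size) ∈ boxSet (castBox c.final) := by
  have h := ((sound hc hy0).2 y rfl hy).1 c.size le_rfl
  rwa [initAt, stageAt_size] at h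

end EMVChainCert

end Chain

/-! ### The mean value chain certificate as a second `Verifier` for elementary chain instances -/

section VerifierPackaging

variable {n : ℕ}

/-- The mean value chain certificate assembled from an elementary chain instance (code lists,
`W₀`, horizon, final box — the instance type of `eChainVerifier`), a precision and a list of mean
value stages. [cite: NedialkovJacksonCorliss1999, §5 Algorithm I] [cite: MrozekZgliczynski2000, §7.5 Lemma 7.6] -/
def EChainInstance.withEMVStages (I : EChainInstance n) (cfg : SeedCfg) (l : List (EMVStage n)) :
    EMVChainCert n :=
  ⟨I.field, cfg, l, I.final⟩

/-- **The mean-value-form chain certificate as a `Verifier`** for the SAME instances and claims as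
`eChainVerifier` (existence on `[0, T]` from every `y₀ ∈ W₀` and `y(T) ∈ F` for every solution):
accept iff `W₀ ⊆` the first stage's box, the steps sum to the horizon, and the mean value chain
check passes; soundness = `EMVChainCert.sound` / `mem_final`.
[cite: Moore1979, §8.1 eq. (8.13)] [cite: Moore1979, §4.3 eq. (4.19)]
[cite: MrozekZgliczynski2000, §7.5 Lemma 7.6] -/
def emvChainVerifier (n : ℕ) : Verifier (EChainInstance n) EChainInstance.Claim where
  Cert := SeedCfg × List (EMVStage n)
  check I p :=
    boxLE I.init ((I.withEMVStages p.1 p.2).initAt 0) &&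
      decide ((I.withEMVStages p.1 p.2).toHOEChain.meshQ p.2.length = I.horizon) &&
        (I.withEMVStages p.1 p.2).check
  sound I p h := by
    simp only [Bool.and_eq_true, decide_eq_true_eq] at h
    obtain ⟨⟨h0, hT⟩, hc⟩ := h
    have hT' : (I.horizon : ℝ) =
        (I.withEMVStages p.1 p.2).toHOEChain.mesh (I.withEMVStages p.1 p.2).size := by
      rw [← hT, HOEChainCert.cast_meshQ]; rfl
    intro y₀ hy₀
    have hy₀' : y₀ ∈ boxSet (castBox ((I.withEMVStages p.1 p.2).initAt 0)) :=
      boxSet_mono (castBox_mono (le_of_boxLE h0)) hy₀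
    refine ⟨?_, fun y hy0 hy => ?_⟩
    · obtain ⟨y, hy0, hy⟩ := (EMVChainCert.sound hc hy₀').1
      exact ⟨y, hy0, by rw [hT']; exact hy⟩
    · rw [hT'] at hy ⊢
      exact EMVChainCert.mem_final hc (hy0 ▸ hy₀') hy

end VerifierPackaging

/-! ### The pendulum from a box: four mean value steps against four direct steps, by the kernel -/

section PendulumBoxChain

/-- The BOX of initial values `W₀ = [0.99, 1.01] × [−0.01, 0.01]` (the box of
`ElementaryFieldMeanValueCertificate.pendulumMV`). [cite: Moore1979, §8.1 eq. (8.13) (interval initial conditions)] -/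
def pendulumBox : Fin 2 → Iv :=
  ![⟨(99 / 100, 101 / 100), by decide +kernel⟩, ⟨(-1 / 100, 1 / 100), by decide +kernel⟩]

/-- **The mean value transcript**: the pendulum `x₁' = x₂`, `x₂' = −sin x₁` (`pendulumField`) from
`W₀`, four steps of `h = 1/8`, `C¹` part at order `4`, point certificates from the midpoints at
order `6`; a-priori boxes `Sⱼ` (grid `10⁻⁴`, also used for the point certificates), one generous
`VV` for all steps, and the hand-over boxes (`meetEndBoxⱼ` rounded outward to `10⁻⁷`) from an
untrusted search. [cite: Moore1979, §8.1 eq. (8.13)] [cite: Moore1979, §4.3 eq. (4.19)]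
[cite: Zgliczynski2002C1Lohner, §3 (C¹-Lohner algorithm: evaluation φ(h,[x]) ⊂ Φ(h,m) + ∂Φ/∂x(h,[x])([x] − m))] -/
def pendulumBoxMVStages : List (EMVStage 2) :=
  [
    ⟨4, 1 / 8, ![⟨(99 / 100, 101 / 100), by decide +kernel⟩, ⟨(-1 / 100, 1 / 100), by decide +kernel⟩],
      ![⟨(9443 / 10000, 10413 / 10000), by decide +kernel⟩, ⟨(-1550 / 10000, 4 / 100), by decide +kernel⟩],
      ![![⟨(994 / 1000, 1001 / 1000), by decide +kernel⟩, ⟨(-13 / 1000, 138 / 1000), by decide +kernel⟩],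
        ![⟨(-9 / 100, 8 / 1000), by decide +kernel⟩, ⟨(994 / 1000, 1001 / 1000), by decide +kernel⟩]],
      ![1, 0], 6, ![⟨(9443 / 10000, 10413 / 10000), by decide +kernel⟩, ⟨(-1550 / 10000, 4 / 100), by decide +kernel⟩]⟩,
    ⟨4, 1 / 8, ![⟨(9822238 / 10000000, 10046375 / 10000000), by decide +kernel⟩, ⟨(-1156831 / 10000000, -943878 / 10000000), by decide +kernel⟩],
      ![⟨(9233 / 10000, 10347 / 10000), by decide +kernel⟩, ⟨(-2607 / 10000, -643 / 10000), by decide +kernel⟩],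
      ![![⟨(994 / 1000, 1001 / 1000), by decide +kernel⟩, ⟨(-13 / 1000, 138 / 1000), by decide +kernel⟩],
        ![⟨(-9 / 100, 8 / 1000), by decide +kernel⟩, ⟨(994 / 1000, 1001 / 1000), by decide +kernel⟩]],
      ![19868613 / 20000000, -2100709 / 20000000], 6, ![⟨(9233 / 10000, 10347 / 10000), by decide +kernel⟩, ⟨(-2607 / 10000, -643 / 10000), by decide +kernel⟩]⟩,
    ⟨4, 1 / 8, ![⟨(9612897 / 10000000, 9862674 / 10000000), by decide +kernel⟩, ⟨(-2205631 / 10000000, -1977795 / 10000000), by decide +kernel⟩],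
      ![⟨(8893 / 10000, 10163 / 10000), by decide +kernel⟩, ⟨(-3656 / 10000, -1677 / 10000), by decide +kernel⟩],
      ![![⟨(994 / 1000, 1001 / 1000), by decide +kernel⟩, ⟨(-13 / 1000, 138 / 1000), by decide +kernel⟩],
        ![⟨(-9 / 100, 8 / 1000), by decide +kernel⟩, ⟨(994 / 1000, 1001 / 1000), by decide +kernel⟩]],
      ![19475571 / 20000000, -2091713 / 10000000], 6, ![⟨(8893 / 10000, 10163 / 10000), by decide +kernel⟩, ⟨(-3656 / 10000, -1677 / 10000), by decide +kernel⟩]⟩,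
    ⟨4, 1 / 8, ![⟨(9273581 / 10000000, 9550710 / 10000000), by decide +kernel⟩, ⟨(-3237190 / 10000000, -2992060 / 10000000), by decide +kernel⟩],
      ![⟨(8425 / 10000, 9851 / 10000), by decide +kernel⟩, ⟨(-4688 / 10000, -2692 / 10000), by decide +kernel⟩],
      ![![⟨(994 / 1000, 1001 / 1000), by decide +kernel⟩, ⟨(-13 / 1000, 138 / 1000), by decide +kernel⟩],
        ![⟨(-9 / 100, 8 / 1000), by decide +kernel⟩, ⟨(994 / 1000, 1001 / 1000), by decide +kernel⟩]],
      ![18824291 / 20000000, -3114625 / 10000000], 6, ![⟨(8425 / 10000, 9851 / 10000), by decide +kernel⟩, ⟨(-4688 / 10000, -2692 / 10000), by decide +kernel⟩]⟩]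

/-- **The instance**: the pendulum from the box `W₀`, horizon `1/2`, claimed final box
`[0.8807098, 0.9113553] × [−0.424149, −0.3976079]`. [cite: Moore1979, §8.1 eq. (8.13)] -/
def pendulumBoxMVInstance : EChainInstance 2 :=
  ⟨pendulumField, pendulumBox, 1 / 2,
    ![⟨(8807098 / 10000000, 9113553 / 10000000), by decide +kernel⟩, ⟨(-4241490 / 10000000, -3976079 / 10000000), by decide +kernel⟩]⟩

/-- The mean value chain certificate of the transcript (= the verifier's internal certificate), at
`40`-bit outward rounding with seeds at scale `2^30` (`12` terms, `3` halvings).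
[cite: Moore1979, §8.1 eq. (8.13)] [cite: MrozekZgliczynski2000, §7.5 Lemma 7.6] -/
def pendulumBoxMVChain : EMVChainCert 2 :=
  pendulumBoxMVInstance.withEMVStages ⟨40, 30, 12, 3, 0⟩ pendulumBoxMVStages

set_option maxHeartbeats 0 in
/-- **The kernel accepts the four-step mean value transcript** (≈ 40 s of kernel reduction: four
`C¹` HOE tests and four point certificates over the derived code lists).
[cite: Moore1979, §8.1 eq. (8.13)] [cite: Moore1979, §4.3 eq. (4.19)] -/
theorem pendulumBoxMVChain_check : pendulumBoxMVChain.check = true := by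
  decide +kernel

/-- The transcript has four steps. [cite: Moore1979, §8.1 eq. (8.13)] -/
theorem pendulumBoxMVChain_size : pendulumBoxMVChain.size = 4 := rfl

/-- Its horizon is `τ₄ = 1/2`, in exact rational arithmetic. [cite: Moore1979, §8.1 eq. (8.13)]
[cite: Moore1966, §4.4] -/
theorem pendulumBoxMVChain_meshQ : pendulumBoxMVChain.toHOEChain.meshQ 4 = 1 / 2 := by
  simp only [HOEChainCert.meshQ, Finset.sum_range_succ, Finset.sum_range_zero,
    EMVChainCert.toHOEChain_step, EMVChainCert.stageAt, pendulumBoxMVChain,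
    pendulumBoxMVInstance, pendulumBoxMVStages, EChainInstance.withEMVStages,
    List.getD_cons_zero, List.getD_cons_succ]
  norm_num

/-- Its horizon is `τ₄ = 1/2`. [cite: Moore1979, §8.1 eq. (8.13)] -/
theorem pendulumBoxMVChain_mesh : pendulumBoxMVChain.toHOEChain.mesh 4 = 1 / 2 := by
  rw [← HOEChainCert.cast_meshQ, pendulumBoxMVChain_meshQ]
  norm_num

/-- **Existence on `[0, 1/2]` from every point of the box** (kernel-certified).
[cite: Moore1979, §8.1 eq. (8.13)] -/
theorem pendulumBoxMVChain_exists {y₀ : Fin 2 → ℝ} (hy₀ : y₀ ∈ boxSet (castBox pendulumBox)) :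
    ∃ y : ℝ → Fin 2 → ℝ, y 0 = y₀ ∧
      ∀ t ∈ Icc (0 : ℝ) (1 / 2),
        HasDerivWithinAt y (fieldFun pendulumField (y t)) (Icc (0 : ℝ) (1 / 2)) t := by
  have h := (EMVChainCert.sound pendulumBoxMVChain_check (y₀ := y₀) hy₀).1
  rwa [pendulumBoxMVChain_size, pendulumBoxMVChain_mesh] at h

/-- **Enclosure at `t = 1/2` from the box** (kernel-certified): every solution of the pendulum
from any `y₀ ∈ W₀ = [0.99, 1.01] × [−0.01, 0.01]` on `[0, 1/2]` has
`x(1/2) ∈ [0.8807098, 0.9113553] × [−0.424149, −0.3976079]` (widths `0.0306`, `0.0265`; the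
initial widths `0.02` propagated through four mean value hand-overs).
[cite: Moore1979, §8.1 eq. (8.13)] [cite: Moore1979, §4.3 eq. (4.19)]
[cite: MrozekZgliczynski2000, §7.5 Lemma 7.6] -/
theorem pendulumBoxMVChain_final {y₀ : Fin 2 → ℝ} (hy₀ : y₀ ∈ boxSet (castBox pendulumBox))
    {z : ℝ → Fin 2 → ℝ} (hz0 : z 0 = y₀)
    (hz : ∀ t ∈ Icc (0 : ℝ) (1 / 2),
      HasDerivWithinAt z (fieldFun pendulumField (z t)) (Icc (0 : ℝ) (1 / 2)) t) :
    z (1 / 2) ∈ boxSet (castBox pendulumBoxMVInstance.final) := by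
  have h := fun hz' =>
    EMVChainCert.mem_final pendulumBoxMVChain_check (y := z) (hz0 ▸ hy₀) hz'
  rw [pendulumBoxMVChain_size, pendulumBoxMVChain_mesh] at h
  exact h hz

/-- **The direct transcript for comparison**: the same field, box, mesh and order with the direct
Taylor end boxes (rounded outward to `10⁻⁷`) as hand-over boxes — a certificate of
`ElementaryFieldChainCertificate.lean` (untrusted search, recorded as data).
[cite: Moore1979, §8.1 eq. (8.13)] [cite: NedialkovJacksonCorliss1999, §5 Algorithm I] -/
def pendulumBoxDirectStages : List (HOEStage 2) :=
  [⟨4, 1 / 8, ![⟨(99 / 100, 101 / 100), by decide +kernel⟩, ⟨(-1 / 100, 1 / 100), by decide +kernel⟩],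
      ![⟨(9443 / 10000, 10413 / 10000), by decide +kernel⟩, ⟨(-1550 / 10000, 4 / 100), by decide +kernel⟩]⟩,
   ⟨4, 1 / 8, ![⟨(9820878 / 10000000, 10047735 / 10000000), by decide +kernel⟩, ⟨(-1165301 / 10000000, -935435 / 10000000), by decide +kernel⟩],
      ![⟨(9231 / 10000, 10348 / 10000), by decide +kernel⟩, ⟨(-2616 / 10000, -635 / 10000), by decide +kernel⟩]⟩,
   ⟨4, 1 / 8, ![⟨(9608933 / 10000000, 9866637 / 10000000), by decide +kernel⟩, ⟨(-2223677 / 10000000, -1959794 / 10000000), by decide +kernel⟩],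
      ![⟨(8887 / 10000, 10167 / 10000), by decide +kernel⟩, ⟨(-3674 / 10000, -1659 / 10000), by decide +kernel⟩]⟩,
   ⟨4, 1 / 8, ![⟨(9265598 / 10000000, 9558690 / 10000000), by decide +kernel⟩, ⟨(-3265966 / 10000000, -2963359 / 10000000), by decide +kernel⟩],
      ![⟨(8413 / 10000, 9859 / 10000), by decide +kernel⟩, ⟨(-4716 / 10000, -2663 / 10000), by decide +kernel⟩]⟩]

/-- The direct chain certificate from the box, claimed final box
`[0.8793499, 0.9127144] × [−0.4282153, −0.3935533]`. [cite: Moore1979, §8.1 eq. (8.13)] -/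
def pendulumBoxDirectChain : EChainCert 2 :=
  ⟨pendulumField, ⟨40, 30, 12, 3, 0⟩, pendulumBoxDirectStages,
    ![⟨(8793499 / 10000000, 9127144 / 10000000), by decide +kernel⟩, ⟨(-4282153 / 10000000, -3935533 / 10000000), by decide +kernel⟩]⟩

set_option maxHeartbeats 0 in
/-- **The kernel accepts the direct transcript too** (so its final box is an honest competitor:
`EChainCert.mem_final`). [cite: Moore1979, §8.1 eq. (8.13)] -/
theorem pendulumBoxDirectChain_check : pendulumBoxDirectChain.check = true := by
  decide +kernel

/-- **Mean value chain versus direct chain from a box** (the wrapping / dependency effect,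
kernel-checked): the final box of the mean value transcript is contained in the final box
`[0.8793499, 0.9127144] × [−0.4282153, −0.3935533]` of the direct transcript for the same problem,
box, mesh and order — widths `0.0306 × 0.0265` against `0.0334 × 0.0347`.  (The gain is modest
because the pendulum flow shears: interval sets wrap in either form, MZ2000 §8.)
[cite: Moore1979, §8.2 (the wrapping effect)] [cite: Moore1979, §4.3 eq. (4.19)]
[cite: MrozekZgliczynski2000, §8 (p. 249)] -/
theorem pendulumBoxMVChain_final_le_direct :
    boxLE pendulumBoxMVInstance.final pendulumBoxDirectChain.final = true := by
  decide +kernel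

/-- **The verifier's claim for the instance** (existence on `[0, 1/2]` from every point of `W₀`
and `y(1/2) ∈ F` for every solution), extracted from `emvChainVerifier` with (precision, stages)
as the certificate; the verifier's own landing and horizon tests are discharged by `decide` and
`pendulumBoxMVChain_meshQ`, the chain check is `pendulumBoxMVChain_check`.
[cite: Moore1979, §8.1 eq. (8.13)] [cite: MrozekZgliczynski2000, §7.5 Lemma 7.6] -/
theorem pendulumBoxMVChain_claim : pendulumBoxMVInstance.Claim := by
  refine (emvChainVerifier 2).sound (c := (⟨40, 30, 12, 3, 0⟩, pendulumBoxMVStages)) ?_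
  show (boxLE pendulumBoxMVInstance.init (pendulumBoxMVChain.initAt 0) &&
      decide (pendulumBoxMVChain.toHOEChain.meshQ pendulumBoxMVStages.length =
        pendulumBoxMVInstance.horizon) && pendulumBoxMVChain.check) = true
  rw [pendulumBoxMVChain_check, Bool.and_true, Bool.and_eq_true]
  exact ⟨by decide +kernel, decide_eq_true pendulumBoxMVChain_meshQ⟩

end PendulumBoxChain

end Literature.Analysis.ODE
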